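import Summits.QuantumFields.BalabanUV.Beta.D1BFx.CoarseLegJunction
import Summits.QuantumFields.BalabanUV.Beta.D1BFx.StraightPinVertexFamilies

/-!
# `BalabanUV.Beta.D1BFx.StraightPinMultiplierEnvelope` — road «BF-x» for binder row D1, slot (K), PART 24 HEAD «TWO PINS», «WPHI-ENVELOPE»:
# **THE MULTIPLIER-RESPONSE BLOCK `wΦ^{(n)}` OF THE PACKED ONE-STEP RESOLVENT HAS THE DISPLAYED ENVELOPE `hΦ` HYPOTHESIS-FREE, WITH n-UNIFORM CONSTANTS** —
# `|wΦ^{(n)} ρ ν w| ≤ (2·c166Z 3)·(n⁵)⁻¹·(n³)⁻¹·e^{−kappaZ 3·‖w‖∞}` for EVERY block size `n ≥ 1`, i.e. the binder `hΦ` of gan24-leaf-05 g62's «K0-VF-PACK»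
# (`StraightPinVertexFamilies.vertexFamily_vertexOfM_K₀_of_wΦ` ∕ `_M1Of_record`, and «G0-VF-PACK»'s `vertexFamily_vertexOfM_K₀∕G₀_symHessFFAt_record`) at
# `CΦ := 2·c166Z 3`, `κ₀ := kappaZ 3` — the `(inr,inr)` third of the OWNER's «G0-DECAY» WANTED (W-g25-5 (b), l.53983) in closed form: this lineage's T3
# `CoarseLeg.abs_CunZ_le` read through the typer's junction `CoarseLegJunction.abs_wΦ_le` (`wΦ^{(n)} = 2n⁻⁸·CunZ n`), with `|w|₁ ≥ ‖w‖∞`.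

HONEST DEPENDENCY (cell records, verbatim): «continuum YM on T⁴ ⇐ BetaPertH ∧ nine spine estimates (0/9 proved); BetaPertH ⇐ (D1) ∧ (D4) ∧
CAP+tail; G-an2-4 gates asym, D1 and NE2/3/4.»  HONEST FRAMING (cell contract, verbatim): «discharging `BetaPertH` makes Bałaban's UV stability
UNCONDITIONAL — a real constructive-QFT result; it is NOT the continuum limit and NOT the Clay problem.»  THIS MODULE DISCHARGES NOTHING of the
wall: [folklore] bookkeeping BY NAME (`CoarseLegJunction.abs_wΦ_le`, lit `B4ContourShift.exists_supNorm_eq`, `DirichletExhaustionDeltaZ.kappaZ_pos`, and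
two instantiations of «K0-VF-PACK»); it discharges ONE displayed hypothesis (`hΦ`) of the HEAD's `hV` letters — nothing of Bałaban's asserted or valued,
no (1.22) row, no `n`-count claimed (the constants are DISPLAYED; `Zl 4 (δ∕2)`, `ell(4,n)²` stay symbolic).  No definition, no `def … : Prop`, nothing cited,
0 sorry.  0 root-level binders of row D1 discharged (hW ∕ hR-sockets ∕ hSX-socket ∕ D1Tel ∕ D1Rep = 0); (J1) ONE OPEN ROW; (K) NOT closed; NOT D1, NEVER
«G-an2-4 closed», NOT `BetaPertH`, NOT continuum, NOT Clay.

ABSOLUTE RULE (cell charter, verbatim): «No internally-minted statement may enter as a cited fact. Every hypothesis is either kernel-proved in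
this package or a verbatim quotation of a PUBLISHED theorem with page reference. The manuscript(s) under audit are NOT citable for their own
disputed steps — they are the thing under adjudication; programme-internal (2001/route/tribunal) claims are never citable.»

WHY.  «K0-VF-PACK» FILE 1 §2∕§4 (p366947 ✓) and «G0-VF-PACK» §3 display the multiplier envelope as a hypothesis
`hΦ : ∀ ρ ν w, |wΦ^{(n)} ρ ν w| ≤ CΦ·(n⁵)⁻¹·(n³)⁻¹·e^{−κ₀‖w‖∞}` («the SHAPE of d4-p3's level-uniform `RemainderExplicitMultiplier.exists_wΦ_decay`», an
`∃ κ₀ C`), and the OWNER's W-g25-5 (b) asks for the leg letters of the HEAD's rows in CLOSED form.  For the `(inr,inr)` block the tree already HAS a closed,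
n-UNIFORM letter: `CoarseLegJunction.abs_wΦ_le` (`|wΦ^{(n)} κ l z| ≤ 2n⁻⁸·c166Z 3·e^{−kappaZ 3·|z|₁}`, every `n ≥ 1`; `c166Z 3 = 4·4²·MG 4`,
`kappaZ 3 = κ₁₆₆(4)∕4`, decay in the COARSE variable).  Since `‖w‖∞ ≤ |w|₁` and `n⁻⁸ = (n⁵)⁻¹·(n³)⁻¹`, that letter IS `hΦ` with `CΦ := 2·c166Z 3`, `κ₀ := kappaZ 3`.

CONTENT ([folklore]; `n ≥ 1` via `[NeZero n]`).
* §1 **`abs_wΦ_le_hΦ`** (`‖w‖∞ ≤ |w|₁` inline, lit `exists_supNorm_eq` + `single_le_sum`): `|wΦ^{(n)} ρ ν w| ≤ (2·c166Z 3)·(n⁵)⁻¹·(n³)⁻¹·e^{−(kappaZ 3·‖w‖∞)}` —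
  EXACTLY the binder shape `hΦ` of «K0-VF-PACK» ∕ «G0-VF-PACK», `0 < kappaZ 3` by `kappaZ_pos`.
* §2 the two «K0-VF-PACK» letters HYPOTHESIS-FREE: **`vertexFamily_vertexOfM_K₀_free`** (any multiplier-table family `VertexFamily M n Cq δ`, `0 < δ ≤ kappaZ 3∕(4n)`) and
  **`vertexFamily_vertexOfM_K₀_M1Of_record_free`** (the record's `tabs.M j`), constants = FILE 1's with `CΦ := 2·c166Z 3`, `κ₀ := kappaZ 3` substituted.
NOT HERE (honest): the `ff`∕`fm`∕`mf` blocks of «G0-DECAY» (`Decays (coDressKBmAt ρ_c n K₀) C_G(n) δ_G(n)` — the packed-currency lineage's ∕ R-T's); «G0-VF-PACK»'s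
`V_H` corollaries (one application of §1 on the consumer's side, its file not imported here); any (1.22) row; whether `Zl 4 (δ∕2)·ell(4,n)²` is n-free.
Unit `b2b-balaban-beta-d1-formalise-leaf-04` (gen 28), D1 formalisation swarm, road «BF-x»; INTENT I-leaf04-g28-1 «WPHI-ENVELOPE» (journal).  No existing file touched.
-/

noncomputable section

namespace Summit.QuantumFields.BalabanUV.Beta.D1BFx.StraightPinMultiplierEnvelope

open Finset
open scoped BigOperators
open Literature.MathematicalPhysics.QuantumFieldTheory.Balaban1983to89
open Literature.MathematicalPhysics.QuantumFieldTheory.Balaban1983to89.Beta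
open B12Sec2to5 (l1)
open B4ContourShift (supNorm exists_supNorm_eq)
open ExpKernelCalculus (Site MKer Zl VertexFamily)
open AveragingHessianKernels (ell)
open KernelSpecInstance (wΦ)
open OneStepResolventKernel (Fib)
open OneStepKernelFamily (KInvStep)
open SecondOrderResponse (vertexOfM)
open BalabanStepW2 (wM1)
open Summit.QuantumFields.BalabanUV.Beta.SymSecondOrderTablesAn1 (symTablesAn1S2)
open Summit.QuantumFields.BalabanUV.Beta.GAN24.DirichletExhaustionDeltaZ (c166Z kappaZ kappaZ_pos)
open Summit.QuantumFields.BalabanUV.Beta.D1BFx.CoarseLegJunction (abs_wΦ_le)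
open Summit.QuantumFields.BalabanUV.Beta.D1BFx.StraightPinVertexFamilies (vertexFamily_vertexOfM_K₀_of_wΦ)

variable (n : ℕ) [NeZero n]

/-! ## §1 The multiplier envelope in the `hΦ` shape, hypothesis-free -/

/-- [folklore] **THE MULTIPLIER ENVELOPE `hΦ`, HYPOTHESIS-FREE, n-UNIFORM CONSTANTS**: for every block size `n ≥ 1`, all directions `ρ ν` and every coarse
site `w`, `|wΦ^{(n)} ρ ν w| ≤ (2·c166Z 3)·(n⁵)⁻¹·(n³)⁻¹·e^{−(kappaZ 3·‖w‖∞)}` — `CoarseLegJunction.abs_wΦ_le` (`2n⁻⁸·c166Z 3·e^{−kappaZ 3·|w|₁}`) with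
`‖w‖∞ ≤ |w|₁`; EXACTLY the binder `hΦ` of `StraightPinVertexFamilies.vertexFamily_vertexOfM_K₀_of_wΦ` at `CΦ := 2·c166Z 3`, `κ₀ := kappaZ 3`. -/
theorem abs_wΦ_le_hΦ (ρ ν : Fin (3 + 1)) (w : Fin (3 + 1) → ℤ) :
    |wΦ (N := n) ρ ν w| ≤ (2 * c166Z 3) * ((n : ℝ) ^ 5)⁻¹ * ((n : ℝ) ^ 3)⁻¹ * Real.exp (-(kappaZ 3 * supNorm w)) := by
  have h := abs_wΦ_le n ρ ν w
  have hn : (0 : ℝ) < (n : ℝ) := by exact_mod_cast Nat.pos_of_ne_zero (NeZero.ne n)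
  have hc : 0 ≤ 2 * ((n : ℝ) ^ 8)⁻¹ * c166Z 3 := by
    have h0 := (abs_nonneg _).trans (abs_wΦ_le n 0 0 0)
    exact (mul_nonneg_iff_of_pos_right (Real.exp_pos _)).1 h0
  have hexp : Real.exp (-(kappaZ 3) * l1 w) ≤ Real.exp (-(kappaZ 3 * supNorm (d := 3) w)) := by
    refine Real.exp_le_exp.2 ?_
    have hκ := kappaZ_pos 3
    -- `‖w‖∞ ≤ |w|₁` (as in `GAN24.RespStepCauchy.supNorm_le_l1`, not imported here)
    have hs : supNorm (d := 3) w ≤ l1 w := by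
      obtain ⟨i, hi⟩ := exists_supNorm_eq (d := 3) w
      rw [hi, Int.cast_abs]
      unfold l1
      exact Finset.single_le_sum (f := fun j => |((w j : ℤ) : ℝ)|) (fun j _ => abs_nonneg _) (Finset.mem_univ i)
    nlinarith
  calc |wΦ (N := n) ρ ν w| ≤ 2 * ((n : ℝ) ^ 8)⁻¹ * c166Z 3 * Real.exp (-(kappaZ 3) * l1 w) := h
    _ ≤ 2 * ((n : ℝ) ^ 8)⁻¹ * c166Z 3 * Real.exp (-(kappaZ 3 * supNorm (d := 3) w)) := mul_le_mul_of_nonneg_left hexp hc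
    _ = (2 * c166Z 3) * ((n : ℝ) ^ 5)⁻¹ * ((n : ℝ) ^ 3)⁻¹ * Real.exp (-(kappaZ 3 * supNorm (d := 3) w)) := by
        have h8 : ((n : ℝ) ^ 8)⁻¹ = ((n : ℝ) ^ 5)⁻¹ * ((n : ℝ) ^ 3)⁻¹ := by
          rw [← mul_inv, ← pow_add]
        rw [h8]; ring

/-- [folklore] `0 < kappaZ 3` re-exported in the `hκ₀` slot of «K0-VF-PACK». -/
theorem kappaZ_three_pos : 0 < kappaZ 3 := kappaZ_pos 3

/-! ## §2 «K0-VF-PACK»'s multiplier-column letters, hypothesis-free -/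

/-- [folklore] **THE STRAIGHT-PIN MULTIPLIER-COLUMN VERTEX IS A VERTEX FAMILY — `hΦ` DISCHARGED**: for every vertex family of multiplier tables
`VertexFamily M n Cq δ` at a rate `0 < δ ≤ kappaZ 3∕(4n)`, `VertexFamily (vertexOfM K₀ n M) n (4·(((2·c166Z 3)·(n⁵)⁻¹·(n³)⁻¹·e^{kappaZ 3})·Cq·Zl 4 (δ∕2))) (δ∕2)`
(`StraightPinVertexFamilies.vertexFamily_vertexOfM_K₀_of_wΦ` at §1). -/
theorem vertexFamily_vertexOfM_K₀_free {M : Fin (3 + 1) → (Fin (3 + 1) → ℤ) → MKer 4 (Fib 3)} {Cq δ : ℝ} (hM : VertexFamily M n Cq δ) (hδ : 0 < δ)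
    (hδ₀ : δ ≤ kappaZ 3 / (4 * (n : ℝ))) :
    VertexFamily (vertexOfM (KInvStep (d := 3) n 0) n M) n
      (4 * (((2 * c166Z 3) * ((n : ℝ) ^ 5)⁻¹ * ((n : ℝ) ^ 3)⁻¹ * Real.exp (kappaZ 3)) * Cq * Zl 4 (δ / 2))) (δ / 2) :=
  vertexFamily_vertexOfM_K₀_of_wΦ n kappaZ_three_pos (abs_wΦ_le_hΦ n) hM hδ hδ₀

/-- [folklore] **`V^M := vertexOfM K₀ n (tabs.M j)` AT THE RECORD IS A VERTEX FAMILY — `hΦ` DISCHARGED** (`tabs = symTablesAn1S2 3 n cΛ`; `0 < δ ≤ kappaZ 3∕(4n)`):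
`StraightPinVertexFamilies.vertexFamily_vertexOfM_K₀_M1Of_record` at §1 — constant `4·(((2·c166Z 3)·(n⁵)⁻¹·(n³)⁻¹·e^{kappaZ 3})·(|cΛ·wM1 3 n j|·2·ell(4,n)²·e^{16nδ})·Zl 4 (δ∕2))`. -/
theorem vertexFamily_vertexOfM_K₀_M1Of_record_free (cΛ : ℝ) (j : ℕ) {δ : ℝ} (hδ : 0 < δ) (hδ₀ : δ ≤ kappaZ 3 / (4 * (n : ℝ))) :
    VertexFamily (vertexOfM (KInvStep (d := 3) n 0) n ((symTablesAn1S2 3 n cΛ).M j)) n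
      (4 * (((2 * c166Z 3) * ((n : ℝ) ^ 5)⁻¹ * ((n : ℝ) ^ 3)⁻¹ * Real.exp (kappaZ 3))
        * (|cΛ * wM1 3 n j| * (2 * (ell (3 + 1) n : ℝ) ^ 2 * Real.exp (4 * ((3 : ℝ) + 1) * n * δ))) * Zl 4 (δ / 2))) (δ / 2) :=
  StraightPinVertexFamilies.vertexFamily_vertexOfM_K₀_M1Of_record n kappaZ_three_pos (abs_wΦ_le_hΦ n) cΛ j hδ hδ₀

end Summit.QuantumFields.BalabanUV.Beta.D1BFx.StraightPinMultiplierEnvelope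

end
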